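import Summits.AtomisticToContinuum.HydrodynamicLimit.Theorems.CollisionIsometryCLTCollisionalTransferLocalitySlavingReduction
import HarnessLib

/-!
# Time-local slaving reduction (registered stub `slavingReductionAt`) of the line
`hemisphere-affine-slaving`, crux `CollisionalTransferLocality` (stmt-AtomisticToContinuum-9518)

The bookkeeping step of the line at ONE admissible kernel family, ONE time horizon `t > 0` and ONE
pair of smooth space–time tests `(ψ, χ)` on `[0, t]`: at fixed `(σ, profiles, Φ)`, the balance
identity [S1] (`BalanceFor σ Φ`: `Cc = J_N` on the good set), the lever (`AffineSlavingIdentity`,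
hence `Sraw_N = S_N` pathwise, `Sraw_eq_Sfun`) and the three convergences in local-Gibbs
probability [A'] `FluxMomentChaos`, [B] `ThermoVirial`, [C] `RelaxC` AT THIS `(kernel, t, ψ, χ)`
imply the crux's conclusion at this `(kernel, t, ψ, χ)`: `Cc − Rhs → 0` in probability, uniformly
in `τ ≤ t`. The landed `stub_slavingReduction` (module `…SlavingReduction`) is the same statement
with all of `t`, kernels and tests quantified inside hypotheses and conclusion; the local form is
the one the PRE-SHOCK composition of the line needs, because after the restatement of the a-priori
crux (stmt-14827: pre-shock, dilute chamber) the exponential velocity moments and the density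
window that feed [A'], [B], [C] are only available per `t < T`.

Proof: verbatim the landed one — on the good set `Cc − Rhs = (J − Sraw) + (S − (Rhs + K)) + K`, the
bad event at level `δ` is covered by the null complement of the good set (`localGibbsLaw ≪
liouville`) and the three bad events at level `δ/3` (`abs_sub_le_of_three_parts`,
`measure_le_add_three_of_subset`), squeeze in `ℝ≥0∞`. No new definitions, no named facts.
-/

namespace Summit.AtomisticToContinuum.HydrodynamicLimit.Theorems.HemisphereAffineSlaving

open scoped BigOperators Topology Manifold Classical MeasureTheory ProbabilityTheory Matrix InnerProductSpace ComplexConjugate ContinuousMap ENNReal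
open Filter Set Function TopologicalSpace MeasureTheory

noncomputable section

open Literature.MathematicalPhysics.KineticTheory (T3 V3)

/-- **Registered stub `slavingReductionAt`** of crux stmt-AtomisticToContinuum-9518 (line
hemisphere-affine-slaving): the slaving reduction at one `(kernel, t, ψ, χ)`. At fixed
`(σ, profiles, Φ)`: [S1] `BalanceFor σ Φ` ∧ the lever `AffineSlavingIdentity` ∧ [A']
`FluxMomentChaos σ a₀ θ₀ u₀ Φ φ t ψ χ` ∧ [B] `ThermoVirial …` ∧ [C] `RelaxC …` ⟹ for every `δ > 0`,
`localGibbsLaw {∃ τ ≤ t, δ < |Cc − Rhs|} → 0` (the crux's conclusion at this kernel, horizon and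
test pair, in the line's vocabulary — definitionally the crux's `let`-telescope). [folklore] -/
theorem slavingReductionAt : ∀ (σ : ℝ) (a₀ θ₀ : T3 → ℝ) (u₀ : T3 → V3) (Φ : Flows σ), BalanceFor σ Φ → AffineSlavingIdentity → ∀ {γ C : ℝ} {φ : ℕ → T3 → ℝ}, AdmissibleKernel γ C φ → ∀ {t : ℝ}, 0 < t → ∀ {ψ : ℝ → T3 → V3} {χ : ℝ → T3 → ℝ}, Literature.Analysis.FunctionSpaces.Torus.IsSmoothSpaceTimeOn (Icc 0 t) ψ → Literature.Analysis.FunctionSpaces.Torus.IsSmoothSpaceTimeOn (Icc 0 t) χ → FluxMomentChaos σ a₀ θ₀ u₀ Φ φ t ψ χ → ThermoVirial σ a₀ θ₀ u₀ Φ φ t ψ χ → RelaxC σ a₀ θ₀ u₀ Φ φ t ψ χ → ∀ δ : ℝ, 0 < δ → Tendsto (fun N : ℕ => Literature.MathematicalPhysics.KineticTheory.localGibbsLaw σ a₀ u₀ θ₀ N (Φ N) {z | ∃ τ ∈ Icc 0 t, δ < |Cc σ Φ ψ χ N z τ - Rhs σ Φ φ ψ χ N z τ|}) atTop (𝓝 0)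 := by
  intro σ a₀ θ₀ u₀ Φ hBal hId γ C φ hadm t ht ψ χ hψ hχ hA hB hC δ hδ
  have hδ3 : 0 < δ / 3 := by positivity
  have hA' := hA (δ / 3) hδ3
  have hB' := hB (δ / 3) hδ3
  have hC' := hC (δ / 3) hδ3
  have hsum := hA'.add (hB'.add hC')
  rw [add_zero, add_zero] at hsum
  refine tendsto_of_tendsto_of_tendsto_of_le_of_le tendsto_const_nhds hsum (fun _ => zero_le)
    fun N => ?_
  -- the complement of the good set is null for the local Gibbs law (`≪ liouville`)
  have hnull : Literature.MathematicalPhysics.KineticTheory.localGibbsLaw σ a₀ u₀ θ₀ N (Φ N)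
      (Φ N).goodᶜ = 0 := by
    unfold Literature.MathematicalPhysics.KineticTheory.localGibbsLaw
      Literature.Analysis.FluidPDE.particleLaw
    exact withDensity_absolutelyContinuous _ _ (Φ N).measure_compl_good
  refine measure_le_add_three_of_subset _ hnull ?_
  rintro z ⟨τ, hτ, hzδ⟩
  by_cases hz : z ∈ (Φ N).good
  · right
    have h1 : Cc σ Φ ψ χ N z τ = Jfun σ Φ ψ χ N z τ := hBal N t ht ψ χ hψ hχ z hz τ hτ
    have h2 : Sraw σ Φ φ ψ χ N z τ = Sfun σ Φ φ ψ χ N z τ :=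
      Sraw_eq_Sfun hId σ Φ φ ψ χ N (hadm.2.1 N) z τ
        (fun s hs => hψ.isSmooth_slice ⟨hs.1.le, hs.2.trans hτ.2⟩)
    by_contra hno
    simp only [Set.mem_union, Set.mem_setOf_eq, not_or, not_exists, not_and, not_lt] at hno
    obtain ⟨hn1, hn2, hn3⟩ := hno
    have hle := abs_sub_le_of_three_parts h1 h2 (hn1 τ hτ) (hn2 τ hτ) (hn3 τ hτ)
    exact absurd hzδ (not_lt.2 hle)
  · exact Or.inl hz

end

end Summit.AtomisticToContinuum.HydrodynamicLimit.Theorems.HemisphereAffineSlaving
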